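import Summits.HodgeConjecture.HodgeCM.Model.AdelicThetaDistributionMultPinG_1

/-! PORT of `HodgeCM/Model/AdelicThetaDistributionMultPinG.lean` (HodgeCMPerL run 82) — part 2: continuation of `Summits.HodgeConjecture.HodgeCM.Model.AdelicThetaDistributionMultPinG_1` (split at a top-level declaration boundary by port_pkg.py; scope re-opened below; declarations unchanged). -/

-- port_pkg: scope re-opened for this part (file-level context, then the namespace/section stack open at the cut)
set_option autoImplicit false
noncomputable section
open NumberField hiding relNormOneIdeles relNormOneRat probHaarRelNormOneQuot
open _root_.NumberField.InfinitePlace _root_.NumberField.mixedEmbedding MeasureTheory MulAction IsDedekindDomain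
open scoped Matrix TensorProduct Classical SchwartzMap
open Literature.Geometry.ComplexHyperbolic.BallModel (U21 x₀ stabilizerEquivK21)
open Literature.NumberTheory.Automorphic.U21 (K21 matA sclD)
open Literature.NumberTheory.Automorphic Literature.NumberTheory.Automorphic.UnitaryGroup Literature.NumberTheory.Weil1964
open Literature.NumberTheory.GelbartRogawski1991 Literature.NumberTheory.GelbartRogawski1991.UnitaryDualPair
open Literature.AlgebraicGeometry.HodgeTheory Literature.AlgebraicGeometry.ShimuraVarieties Literature.AlgebraicGeometry.ShimuraVarieties.BallForms
open Literature.NumberTheory.Automorphic.PicardCM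
open Literature.NumberTheory.Transcendental (Arapura2012_Cor_15_4_6)
open Literature.Analysis.SegalBargmann
open HodgeCM.Adelic HodgeCM.PerL34 HodgeCM.Model.HypCensus HodgeCM.Model.ArchSideTerm HodgeCM.Model.ThetaDistFin HodgeCM.Model.TowerCarrier
open HodgeCM.Model.SupplyInstance HodgeCM.Model.SupplyResidual HodgeCM.Model.ThetaSpace
open HodgeCM.Model.SupplyResidual.WeilPairData (charInv)
namespace HodgeCM.Model
namespace ThetaAdelicSide
variable (hHD : exists_isReal_hodgeModel) (hI : hodgePQ_independent_of_hodgeModel)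
  (h₁ : BallQuotientUniformised) (h₃ : CMAbelianVarietyRealised) (hA : Arapura2012_Cor_15_4_6)
variable {L : CMField} {ι₁ : L →+* ℂ} (V : HermSpace3 L ι₁) (c : SeesawCtx L) (S : ThetaAdelicSide V c)
  (hGR : (cmSplittingDatum (L : Type) finProdFinEquiv (frameD V) (frameD_real V) (frameD_ne V) (dW c.D) (dW_real c.D)
    (dW_ne c.D)).CompatibleSplitting)
  (hGR₀ : (cmSplittingDatum (L : Type) (e₁) (frameD V) (frameD_real V) (frameD_ne V) (lineVec (L : Type) (dW c.D 0))
    (fun _ => dW_real c.D 0) (fun _ => dW_ne c.D 0)).CompatibleSplitting)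
  (hGR₁ : (cmSplittingDatum (L : Type) (e₁) (frameD V) (frameD_real V) (frameD_ne V) (lineVec (L : Type) (dW c.D 1))
    (fun _ => dW_real c.D 1) (fun _ => dW_ne c.D 1)).CompatibleSplitting)
  (hGR₂ : (cmSplittingDatum (L : Type) (e₁) (frameD V) (frameD_real V) (frameD_ne V) (lineVec (L : Type) (dW' c.D 0))
    (fun _ => dW'_real c.D 0) (fun _ => dW'_ne c.D 0)).CompatibleSplitting)
  (hGR₃ : (cmSplittingDatum (L : Type) (e₁) (frameD V) (frameD_real V) (frameD_ne V) (lineVec (L : Type) (dW' c.D 1))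
    (fun _ => dW'_real c.D 1) (fun _ => dW'_ne c.D 1)).CompatibleSplitting)
  (χ₀ χ₁ χ₂ χ₃ : CMAdelic (L : Type) (frameD V) × CMAdelicOne (L : Type) →* ℂˣ)
  (hι : S.ιinf = archInfOf V)
  (h₁W : (∀ j, 0 < (ι₁ (dW c.D j)).re) ∨ ∀ j, (ι₁ (dW c.D j)).re < 0)
  (hV : IsAnisotropic L V.Hm)
  (hemb : (InfinitePlace.mk ι₁).embedding = ι₁)
section DefaultSplit
variable
  (η : CMAdelic (L : Type) (frameD V) × CMAdelic (L : Type) (dW c.D) →* ℂˣ)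
  (hη : ∀ γU ∈ CMRat (L : Type) (frameD V), ∀ γ ∈ CMRat (L : Type) (dW c.D), η (γU, γ) = 1)
  (hηc : Continuous fun p => ((η p : ℂˣ) : ℂ))
  (A : ∀ k : Fin 4, ArchLineInput V (lineRepD V c.D hGR hGR₀ hGR₁ hGR₂ hGR₃ η k))
/-- Certification (a named theorem here; an `example` in the HodgeCMPerL source): the G-indexed slot-0 pin datum
`pinDatumZeroG` at the default splitting is `pinDatumZero` by `rfl`. -/
theorem pinDatumZeroG_eq_pinDatumZero
  (eR : PosIdx (cmXW (L : Type) (frameD V) (lineVec (L : Type) (dW c.D 0)) (fun _ => dW_real c.D 0) ι₁ (HypCensus.cmPlace (L : Type) ι₁)) ≃ Unit)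
  (eS : NegIdx (cmXW (L : Type) (frameD V) (lineVec (L : Type) (dW c.D 0)) (fun _ => dW_real c.D 0) ι₁ (HypCensus.cmPlace (L : Type) ι₁)) ≃ Empty)
  (hχ : ∀ u : stabilizer U21 x₀,
    ((lineScalar_zero V c.D hGR hGR₀ hGR₁ (eta₀ V c.D η) (u : U21) : ℂˣ) : ℂ) *
        ((matA (stabilizerEquivK21.symm u)).det ^ (lineVacExponentsZero V c hGR₀ h₁W eR eS).eP *
          sclD (stabilizerEquivK21.symm u) ^ (lineVacExponentsZero V c hGR₀ h₁W eR eS).eQ) =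
      star (sclD (stabilizerEquivK21.symm u)))
  (a : {v : InfinitePlace ↥(maximalRealSubfield L) // v.IsReal} → ℤ)
  (hω : ∀ b : {v : InfinitePlace ↥(maximalRealSubfield L) // v.IsReal}, b ≠ HypCensus.cmPlace (L : Type) ι₁ →
    ∀ (u : UnitaryGroup.archLocal (L : Type) 3 (Matrix.diagonal (frameD V)) (cmPlaceOver (L : Type) b)) (ℓ : Module.Dual ℂ (Fin 2 → ℂ)),
      cmArchWeilRep (L : Type) e₁ (frameD V) (frameD_real V) (frameD_ne V) (lineVec (L : Type) (dW c.D 0)) (fun _ => dW_real c.D 0)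
          (fun _ => dW_ne c.D 0) hGR₀
          (UnitaryGroup.archSingle (↥(maximalRealSubfield L)) L (IsCMField.complexConj L) 3 (Matrix.diagonal (frameD V))
            (IsCMField.complexConj_ne_one L) (NumberField.complexConj_smul_infinitePlace (L : Type)) (cmPlaceOver (L : Type) b) u, 1)
          (blockFamilyOfAt (L : Type) e₁ (frameD V) (frameD_real V) (frameD_ne V) (lineVec (L : Type) (dW c.D 0)) (fun _ => dW_real c.D 0)
            (fun _ => dW_ne c.D 0) ι₁ (blockPosEquiv V) (blockNegEquiv V) eR eS (degOnePDual Empty) (binvPi 1) ℓ) =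
        (((u : UnitaryGroup.archLocal (L : Type) 3 (Matrix.diagonal (frameD V)) (cmPlaceOver (L : Type) b)) : GL (Fin 3) ℂ) :
            Matrix (Fin 3) (Fin 3) ℂ).det ^ a b •
          blockFamilyOfAt (L : Type) e₁ (frameD V) (frameD_real V) (frameD_ne V) (lineVec (L : Type) (dW c.D 0)) (fun _ => dW_real c.D 0)
            (fun _ => dW_ne c.D 0) ι₁ (blockPosEquiv V) (blockNegEquiv V) eR eS (degOnePDual Empty) (binvPi 1) ℓ)
  (hdefI : ∀ b : {v : InfinitePlace ↥(maximalRealSubfield L) // v.IsReal}, b ≠ HypCensus.cmPlace (L : Type) ι₁ →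
    ∀ u : UnitaryGroup.archLocal (L : Type) 3 (Matrix.diagonal (frameD V)) (cmPlaceOver (L : Type) b),
      ((archScalar_zeroG V c.D hGR hGR₀ hGR₁ (eta₀ V c.D η)
          (UnitaryGroup.archSingle (↥(maximalRealSubfield L)) L (IsCMField.complexConj L) 3 (Matrix.diagonal (frameD V))
            (IsCMField.complexConj_ne_one L) (NumberField.complexConj_smul_infinitePlace (L : Type)) (cmPlaceOver (L : Type) b) u) : ℂˣ) : ℂ) *
        (((u : UnitaryGroup.archLocal (L : Type) 3 (Matrix.diagonal (frameD V)) (cmPlaceOver (L : Type) b)) : GL (Fin 3) ℂ) :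
            Matrix (Fin 3) (Fin 3) ℂ).det ^ a b = 1)
    :
    pinDatumZeroG V c (archSideOf V c hGR hGR₀ hGR₁ hGR₂ hGR₃ η hη hηc h₁W A) hGR hGR₀ hGR₁ hGR₂ hGR₃
        (eta₀ V c.D η) (eta₁ V c.D η) (eta₂ V c.D η) (eta₃ V c.D η) rfl h₁W hV hemb rfl
        (continuous_cmEta₀ (L : Type) (frameD V) (dW c.D) η hηc) eR eS hχ a hω hdefI =
      pinDatumZero V c hGR hGR₀ hGR₁ hGR₂ hGR₃ η hη hηc h₁W A hV hemb eR eS hχ a hω hdefI := rfl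

/-- Certification (a named theorem here; an `example` in the HodgeCMPerL source): the G-indexed slot-3 pin datum
`pinDatumThreeG` at the default splitting is `pinDatumThree` by `rfl`. -/
theorem pinDatumThreeG_eq_pinDatumThree
  (eR : PosIdx (cmXW (L : Type) (frameD V) (lineVec (L : Type) (dW' c.D 1)) (fun _ => dW'_real c.D 1) ι₁ (HypCensus.cmPlace (L : Type) ι₁)) ≃ Unit)
  (eS : NegIdx (cmXW (L : Type) (frameD V) (lineVec (L : Type) (dW' c.D 1)) (fun _ => dW'_real c.D 1) ι₁ (HypCensus.cmPlace (L : Type) ι₁)) ≃ Empty)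
  (hχ : ∀ u : stabilizer U21 x₀,
    ((lineScalar_three V c.D hGR hGR₂ hGR₃ (eta₃ V c.D η) (u : U21) : ℂˣ) : ℂ) *
        ((matA (stabilizerEquivK21.symm u)).det ^ (lineVacExponentsThree V c hGR₃ eR eS).eP *
          sclD (stabilizerEquivK21.symm u) ^ (lineVacExponentsThree V c hGR₃ eR eS).eQ) =
      star (sclD (stabilizerEquivK21.symm u)))
  (a : {v : InfinitePlace ↥(maximalRealSubfield L) // v.IsReal} → ℤ)
  (hω : ∀ b : {v : InfinitePlace ↥(maximalRealSubfield L) // v.IsReal}, b ≠ HypCensus.cmPlace (L : Type) ι₁ →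
    ∀ (u : UnitaryGroup.archLocal (L : Type) 3 (Matrix.diagonal (frameD V)) (cmPlaceOver (L : Type) b)) (ℓ : Module.Dual ℂ (Fin 2 → ℂ)),
      cmArchWeilRep (L : Type) e₁ (frameD V) (frameD_real V) (frameD_ne V) (lineVec (L : Type) (dW' c.D 1)) (fun _ => dW'_real c.D 1)
          (fun _ => dW'_ne c.D 1) hGR₃
          (UnitaryGroup.archSingle (↥(maximalRealSubfield L)) L (IsCMField.complexConj L) 3 (Matrix.diagonal (frameD V))
            (IsCMField.complexConj_ne_one L) (NumberField.complexConj_smul_infinitePlace (L : Type)) (cmPlaceOver (L : Type) b) u, 1)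
          (blockFamilyOfAt (L : Type) e₁ (frameD V) (frameD_real V) (frameD_ne V) (lineVec (L : Type) (dW' c.D 1)) (fun _ => dW'_real c.D 1)
            (fun _ => dW'_ne c.D 1) ι₁ (blockPosEquiv V) (blockNegEquiv V) eR eS (degOnePDual Empty) (binvPi 1) ℓ) =
        (((u : UnitaryGroup.archLocal (L : Type) 3 (Matrix.diagonal (frameD V)) (cmPlaceOver (L : Type) b)) : GL (Fin 3) ℂ) :
            Matrix (Fin 3) (Fin 3) ℂ).det ^ a b •
          blockFamilyOfAt (L : Type) e₁ (frameD V) (frameD_real V) (frameD_ne V) (lineVec (L : Type) (dW' c.D 1)) (fun _ => dW'_real c.D 1)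
            (fun _ => dW'_ne c.D 1) ι₁ (blockPosEquiv V) (blockNegEquiv V) eR eS (degOnePDual Empty) (binvPi 1) ℓ)
  (hdefI : ∀ b : {v : InfinitePlace ↥(maximalRealSubfield L) // v.IsReal}, b ≠ HypCensus.cmPlace (L : Type) ι₁ →
    ∀ u : UnitaryGroup.archLocal (L : Type) 3 (Matrix.diagonal (frameD V)) (cmPlaceOver (L : Type) b),
      ((archScalar_threeG V c.D hGR hGR₂ hGR₃ (eta₃ V c.D η)
          (UnitaryGroup.archSingle (↥(maximalRealSubfield L)) L (IsCMField.complexConj L) 3 (Matrix.diagonal (frameD V))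
            (IsCMField.complexConj_ne_one L) (NumberField.complexConj_smul_infinitePlace (L : Type)) (cmPlaceOver (L : Type) b) u) : ℂˣ) : ℂ) *
        (((u : UnitaryGroup.archLocal (L : Type) 3 (Matrix.diagonal (frameD V)) (cmPlaceOver (L : Type) b)) : GL (Fin 3) ℂ) :
            Matrix (Fin 3) (Fin 3) ℂ).det ^ a b = 1)
    :
    pinDatumThreeG V c (archSideOf V c hGR hGR₀ hGR₁ hGR₂ hGR₃ η hη hηc h₁W A) hGR hGR₀ hGR₁ hGR₂ hGR₃
        (eta₀ V c.D η) (eta₁ V c.D η) (eta₂ V c.D η) (eta₃ V c.D η) rfl hV hemb rfl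
        (continuous_cmConjEta₁_comp_snd (L : Type) (frameD V) (dW c.D) (dW' c.D) c.D.isoGL (isoGL_hg₀ c.D) η hηc) eR eS hχ a hω hdefI =
      pinDatumThree V c hGR hGR₀ hGR₁ hGR₂ hGR₃ η hη hηc h₁W A hV hemb eR eS hχ a hω hdefI := rfl

end DefaultSplit

end ThetaAdelicSide
end HodgeCM.Model

end
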